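import Literature.MathematicalPhysics.QuantumFieldTheory.Balaban1983to89.B3DeltaGkZeroLattice
import Literature.MathematicalPhysics.QuantumFieldTheory.Balaban1983to89.B3Ineq31ZeroBox

/-!
# `Balaban1983to89.B3Ineq25ZeroLattice` — T. Bałaban, *(Higgs)₂,₃ quantum fields in a finite volume. III. Renormalization*,
# Commun. Math. Phys. **88** (1983) 411–445 [Balaban1983Higgs3]: inequality (2.5) p. 424, the `δG_k(Ω,Ω₂,B̃)` alternative, for
# the pair of p. 433 *"we substitute G_k(□,0) = G_k(0) + δG_k(□,ηZ^d,0) and we treat δG_k as an external scalar field"*: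
# `‖h δG_k(□,ηℤ^{d+1},0) h′‖_{1,α} ≤ O(e^{−δ₀r₀})·e^{−δ₀dist(supp h, supp h′)}`, PROVED for the MODEL INSTANCE `A = B̃ = 0`, `□` a
# rectangular parallelepiped of unit blocks, unit-cube localizations `h = 1_{□(v)}`, `h′ = 1_{□(v′)} ⊂ □` of DEPTH `r₀ ≥ 3` (label
# distance `≥ r₀ + 1` from `ηℤ^{d+1}∖□`), every scale `k ≥ 1` and every Hölder exponent `0 ≤ α < 1` —
# `B3Sect2StatementsPart2.ScaledKernels.Ineq25 α δ₀ C` DISCHARGED for the concrete carrier `sect2DeltaZeroLattice`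

statement-level skeleton of published theorems with citation tags; proofs where landed; nothing here is a claim about the Yang–Mills mass gap

PDF held: `paper:balaban1983-higgs-2-3-quantum-fields-finite-volume` (journal page = PDF page + 410); p. 414 [PDF 4] (definition of
`δG_k(Ω,Ω₂,B̃) = G_k(Ω,B̃) − G_k(Ω₂,B̃)`), p. 420 [PDF 10] ((1.32) and «This definition extends in a natural way to functions of many
variables … we localize simply by representing Ω₁ as a sum of unit cubes»), p. 424 [PDF 14] ((2.5)), p. 433 [PDF 23] (the
substitution `G_k(□,0) = G_k(0) + δG_k(□,ηZ^d,0)`, localizations in the concentric cube `□₁` at distance `r(L^kε)` from `∂□`) read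
in the OCR text (`p0004.txt`, `p0010.txt`, `p0014.txt`, `p0023.txt`).

(2.5) p. 424, verbatim: *"In the estimates we treat them as external fields and we use the inequalities:
‖h(an operator δG_k(Ω,Ω₂,B̃) or (1.16))h′‖_{1,α} ≤ O(e^{−δ₀dist(Ω₂,∂Ω)} or (e(L^kε)p(L^kε))^{n+n′})e^{−δ₀dist(supp h, supp h′)}, (2.5)
where h, h′ are functions giving the localizations of the vertices."*; p. 414: *"This estimate follows easily from the properties
of the propagators G_k(Ω,A) proved in the next paper."* ([B4] = *Regularity and decay of lattice Green's functions*, CMP **89**).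

CITATION HEADER (lean-in-tree rule).  Part of the lit-balaban TYPED SKELETON (HOME `run/shared/lean/pub/lit-balaban/`), Phase 2:
SKELETON rows **B3.Eq2.5** (decl of record `B3Sect2StatementsPart2.ScaledKernels.Ineq25`, fold owner r15; proved members so far:
the nested-box instances `B3Ineq25ZeroNest` (zero field, gen 6) and `B3Ineq25ConstNest` (constant `B̃₀`, gen 7)) and
**B3.Txt@433**; file 3 of the member «MODEL INSTANCE `A = B̃ = 0`, THE PAIR `(□, ηℤ^{d+1})`» — file 1 `B3GkZeroLattice` builds
`G_k(0)` on `ηℤ^{d+1}` as the limit of the cube propagators, file 2 `B3DeltaGkZeroLattice` proves the SIX KERNEL CLAUSES of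
`δG_k(□,ηℤ^{d+1},0) = G_k(□,0) − G_k(0)|_□` at points of depth `r ≥ 3`; the sequel treats (3.1) for `G_k(0)` itself
(`B3GkZeroLatticeSeparated`: separated kernel clauses; `B3Ineq31ZeroLattice`: row B3.Eq3.1 lattice member).

## What is proved, and how (the published route: [B4] for the two regions ⇒ the kernel clauses ⇒ the norm (1.32))

* §1 the lattice path lemma and §3–§5 the (1.32)-bookkeeping are those of `B3Ineq25ZeroNest` (gen 6) TRANSCRIBED from the
  nested-box kernel `B3DeltaGkZeroNest.dGk` to the lattice kernel `B3DeltaGkZeroLattice.dGkLat` (same fine box `Π[0,nM)` of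
  `□`, same index sets `B3Ineq31ZeroBox.sites/bonds/dirOf/baseOf/pdist`, same SUM form `B3Sect1Statements.norm132` of (1.32) for
  the two-variable field `F(x,x′) = η^{−(d+1)}δG_k(□,ηℤ^{d+1},0;x,x′)` on `□(v) × □(v′)`, derivatives in all `2(d+1)` directions,
  same-direction bond pairs, transport `U ≡ 1`): `kerD`, `derivD`, `normHGH`, `supPart_le`, `derivPart_le`, `holderPart_le`,
  `normHGH_le` — pure assembly from cube-wise kernel bounds;
* §2 the admitted localizations: unit cubes `□(v) ⊂ □` of CUBE DEPTH `r₀` (`CubeDepth M r₀ v`: `r₀ ≤ v_i ≤ M_i − 1 − r₀`), every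
  fine point of which has depth `r₀` (`depth_of_cubeDepth`, `B3DeltaGkZeroLattice.Depth`);
* §4 the carrier `sect2DeltaZeroLattice ℓ k hℓ M a m2 r₀ : ScaledKernels` EXTENDING `B3Ineq210ZeroBox.zeroBoxKernels ℓ k hℓ M a m2`
  of `□` (same `Site`, `dist`, `L`, `η`, `d`, (2.10) kernels — so (2.10) for it is `B3Ineq210ZeroBox.ineq210_zeroBox`,
  `ineq210_iff_zeroBox`) by the (2.5) data: `LocFn` = unit cubes of cube depth `r₀`, `distSupp = dist(□(v),□(v′))`
  (`B3Ineq31ZeroBox.cubeDist`), `distΩ₂ := r₀`, `normDeltaG α h h′ := normHGH …`; `ineq25_iff` (Iff.rfl);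
* §6 **`ineq25_zeroLattice`**: `∀ 0 ≤ α < 1 ∃ δ₀ C > 0 ∀ k ≥ 1, window, box □, r₀ ≥ 3: (sect2DeltaZeroLattice ℓ k hℓ M a m2 r₀).Ineq25
  α δ₀ C` from the six clauses of `B3DeltaGkZeroLattice` at the common rate; §7 `ineq25_zeroLattice_witness`: the binders are
  inhabited (coincident cubes allowed — the kernel is regular on the diagonal).

DECLARED DIVERGENCES (F7). (i) READING of the first factor (as gen 6, GAPS G-B3-14 owner-accepted): print `e^{−δ₀dist(Ω₂,∂Ω)}`; the
cited [B4] (1.12)/Cor. 2.3 bound and the proof control the depth `r₀` of the LOCALIZATIONS inside `□` — on p. 433 this IS the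
print's `r(L^kε)` (localizations in `□₁`, `dist(□₁,∂□) = r(L^kε)`), so for the p. 433 use the two readings coincide. (ii) The (1.16)
alternative of (2.5) and the data of (2.11)–(2.12) are NOT MODELLED (`norm116 := 0`, `eRun := pRun := 0`, `holderDiff := absGavg
:= 0`, `dist2 := distBlock := 0`, `Bond := Unit`); the second conjunct of `Ineq25` holds trivially. (iii) Zero background only
(`B̃ = 0`, `U ≡ 1` — the printed case at this point of p. 433, after the gauge step), `□ = Π[0,M)` block-aligned with Neumann
conditions (print: a cube of size `3r(L^kε)`), `G_k(0)` = the kernel limit of file 1 (`B3GkZeroLattice.GkLat`), `d + 1 ≥ 1`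
arbitrary, constants existential (on `d`, `L`, the window, `α`).  Theorems + `def`s with bodies only, no Literature fact minted,
no `sorry`; standard axioms.  Value = (2.5) discharged for the zero-field instance the print actually uses on p. 433, NOT summit
progress.
Unit `lit-balaban-p03` (Phase-2 proof seat p03, gen 8); HOME `run/shared/lean/pub/lit-balaban/` (rows B3.Eq2.5 / B3.Txt@433,
FILED.md, STATUS.md).
-/

namespace Literature.MathematicalPhysics.QuantumFieldTheory.Balaban1983to89.B3Ineq25ZeroLattice

open Finset Matrix
open Literature.MathematicalPhysics.QuantumFieldTheory.Balaban1983to89.B4ContourShift (supNorm supNorm_nonneg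
  abs_le_supNorm exists_supNorm_eq)
open Literature.MathematicalPhysics.QuantumFieldTheory.Balaban1983to89.B4TorusKernel (supNorm_neg)
open Literature.MathematicalPhysics.QuantumFieldTheory.Balaban1983to89.B4TwoRegion120 (supNorm_sub_comm)
open Literature.MathematicalPhysics.QuantumFieldTheory.Balaban1983to89.B4Reflection242
open Literature.MathematicalPhysics.QuantumFieldTheory.Balaban1983to89.B4BoxCov237
open Literature.MathematicalPhysics.QuantumFieldTheory.Balaban1983to89.B4TwoBox120
open Literature.MathematicalPhysics.QuantumFieldTheory.Balaban1983to89.B4Thm110ZeroBox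
open Literature.MathematicalPhysics.QuantumFieldTheory.Balaban1983to89.B3Ineq210ZeroBox
open Literature.MathematicalPhysics.QuantumFieldTheory.Balaban1983to89.B3GkZeroBoxSeparated
open Literature.MathematicalPhysics.QuantumFieldTheory.Balaban1983to89.B3GkZeroLattice
open Literature.MathematicalPhysics.QuantumFieldTheory.Balaban1983to89.B3DeltaGkZeroLattice
open Literature.MathematicalPhysics.QuantumFieldTheory.Balaban1983to89.B3Ineq31ZeroBox (cubeDist cubeDist_nonneg
  cubeDist_mul_le_supNorm sites bonds dirOf baseOf pdist)
open Literature.MathematicalPhysics.QuantumFieldTheory.Balaban1983to89.B3Sect1Statements (norm132 norm132_nonneg)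
open Literature.MathematicalPhysics.QuantumFieldTheory.Balaban1983to89.B3Sect2StatementsPart2

noncomputable section

variable {d : ℕ}

/-! ## §1 A lattice path lemma (as in `B3Ineq31ZeroBox` §2, private there): on a box-convex set of `ℤ^{d+1}` a function whose
nearest-neighbour differences are `≤ B` varies by at most `B·|y₂ − y₁|₁ ≤ B(d+1)|y₂ − y₁|_∞` -/

/-- A set of lattice points is BOX-CONVEX if with two points it contains every point between them coordinatewise. [folklore] -/
private def BoxConvex (P : (Fin (d + 1) → ℤ) → Prop) : Prop :=
  ∀ y₁ y₂, P y₁ → P y₂ → ∀ y : Fin (d + 1) → ℤ, (∀ i, min (y₁ i) (y₂ i) ≤ y i ∧ y i ≤ max (y₁ i) (y₂ i)) → P y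

/-- kernel: the `ℓ¹` size of a lattice vector as a natural number. [folklore] -/
private def l1 (z : Fin (d + 1) → ℤ) : ℕ := ∑ i, (z i).natAbs

/-- kernel: `Σ_i |z_i| ≤ (d+1)|z|_∞`. [folklore] -/
private theorem l1_le_supNorm (z : Fin (d + 1) → ℤ) : ((l1 z : ℕ) : ℝ) ≤ ((d : ℝ) + 1) * supNorm z := by
  unfold l1
  push_cast
  have h : ∀ i ∈ (univ : Finset (Fin (d + 1))), (((z i).natAbs : ℤ) : ℝ) ≤ supNorm z := fun i _ => by
    rw [Int.natCast_natAbs]; exact abs_le_supNorm z i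
  calc ∑ i, (((z i).natAbs : ℤ) : ℝ) ≤ ∑ _i : Fin (d + 1), supNorm z := sum_le_sum h
    _ = ((d : ℝ) + 1) * supNorm z := by rw [sum_const, card_univ, Fintype.card_fin, nsmul_eq_mul]; push_cast; ring

/-- kernel: **the path lemma** — on a box-convex set, nearest-neighbour differences `≤ B` give `|g(y₂) − g(y₁)| ≤ B·Σ_i|y₂ᵢ − y₁ᵢ|`
(telescoping along a staircase path that stays in the set). [folklore] -/
private theorem abs_sub_le_l1 {P : (Fin (d + 1) → ℤ) → Prop} (hP : BoxConvex P) (g : (Fin (d + 1) → ℤ) → ℝ) {B : ℝ}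
    (hstep : ∀ (y : Fin (d + 1) → ℤ) (i : Fin (d + 1)), P y → P (y + Pi.single i 1) →
      |g (y + Pi.single i 1) - g y| ≤ B) :
    ∀ (n : ℕ) (y₁ y₂ : Fin (d + 1) → ℤ), l1 (y₂ - y₁) = n → P y₁ → P y₂ → |g y₂ - g y₁| ≤ B * n := by
  intro n
  induction n with
  | zero =>
    intro y₁ y₂ hn _ _
    have h0 : y₂ = y₁ := by
      have h : ∀ i, (y₂ - y₁) i = 0 := by
        intro i
        have := (Finset.sum_eq_zero_iff.1 hn) i (mem_univ i)
        exact Int.natAbs_eq_zero.1 this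
      funext i; have := h i; simp only [Pi.sub_apply] at this; linarith
    subst h0
    simp
  | succ n ih =>
    intro y₁ y₂ hn hy₁ hy₂
    have hex : ∃ i, (y₂ - y₁) i ≠ 0 := by
      by_contra h
      push Not at h
      have : l1 (y₂ - y₁) = 0 := Finset.sum_eq_zero fun i _ => by rw [h i]; rfl
      omega
    obtain ⟨i, hi⟩ := hex
    simp only [Pi.sub_apply] at hi
    have hsplit : ∀ z : Fin (d + 1) → ℤ, l1 z = (z i).natAbs + ∑ j ∈ univ.erase i, (z j).natAbs := by
      intro z; unfold l1; rw [← Finset.add_sum_erase _ _ (mem_univ i)]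
    have hbetween : ∀ (e : Fin (d + 1) → ℤ) (s : ℤ), e = Pi.single i s → (s = 1 ∨ s = -1) → (0 < s ↔ y₁ i < y₂ i) →
        P (y₁ + e) ∧ l1 (y₂ - (y₁ + e)) = n ∧ |g (y₁ + e) - g y₁| ≤ B := by
      intro e s he hs hdir
      have hei : e i = s := by rw [he, Pi.single_eq_same]
      have hej : ∀ j, j ≠ i → e j = 0 := fun j hj => by rw [he, Pi.single_eq_of_ne hj]
      have hP1 : P (y₁ + e) := by
        refine hP y₁ y₂ hy₁ hy₂ _ fun j => ?_
        by_cases hj : j = i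
        · subst hj
          rw [Pi.add_apply, hei]
          rcases hs with rfl | rfl
          · have : y₁ j < y₂ j := hdir.1 one_pos
            constructor
            · exact le_trans (min_le_left _ _) (by linarith)
            · exact le_trans (by linarith) (le_max_right _ _)
          · have : ¬ y₁ j < y₂ j := fun h => by have := hdir.2 h; linarith
            have hlt : y₂ j < y₁ j := lt_of_le_of_ne (not_lt.1 this) (fun h => hi (by rw [h]; ring))
            constructor
            · exact le_trans (min_le_right _ _) (by linarith)
            · exact le_trans (by linarith) (le_max_left _ _)
        · rw [Pi.add_apply, hej j hj, add_zero]
          exact ⟨min_le_left _ _, le_max_left _ _⟩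
      have hl1 : l1 (y₂ - (y₁ + e)) = n := by
        have e1 := hsplit (y₂ - y₁)
        have e2 := hsplit (y₂ - (y₁ + e))
        have hrest : ∑ j ∈ univ.erase i, ((y₂ - (y₁ + e)) j).natAbs = ∑ j ∈ univ.erase i, ((y₂ - y₁) j).natAbs := by
          refine sum_congr rfl fun j hj => ?_
          have hji : j ≠ i := (mem_erase.1 hj).1
          simp only [Pi.sub_apply, Pi.add_apply, hej j hji, add_zero]
        have hii : ((y₂ - (y₁ + e)) i).natAbs + 1 = ((y₂ - y₁) i).natAbs := by
          simp only [Pi.sub_apply, Pi.add_apply, hei]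
          rcases hs with rfl | rfl
          · have : y₁ i < y₂ i := hdir.1 one_pos
            omega
          · have : ¬ y₁ i < y₂ i := fun h => by have := hdir.2 h; linarith
            omega
        rw [e1] at hn
        rw [e2, hrest]
        omega
      have hg : |g (y₁ + e) - g y₁| ≤ B := by
        rcases hs with rfl | rfl
        · rw [he]; exact hstep y₁ i hy₁ (he ▸ hP1)
        · have e0 : (y₁ + e) + Pi.single i 1 = y₁ := by
            rw [he, add_assoc, ← Pi.single_add]; simp
          have hP0 : P ((y₁ + e) + Pi.single i 1) := by rw [e0]; exact hy₁
          have h := hstep (y₁ + e) i hP1 hP0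
          rw [e0] at h
          rwa [abs_sub_comm] at h
      exact ⟨hP1, hl1, hg⟩
    have hstep1 : ∃ e : Fin (d + 1) → ℤ, P (y₁ + e) ∧ l1 (y₂ - (y₁ + e)) = n ∧ |g (y₁ + e) - g y₁| ≤ B := by
      by_cases hlt : y₁ i < y₂ i
      · exact ⟨Pi.single i 1, hbetween _ 1 rfl (Or.inl rfl) ⟨fun _ => hlt, fun _ => one_pos⟩⟩
      · exact ⟨Pi.single i (-1), hbetween _ (-1) rfl (Or.inr rfl)
          ⟨fun h => absurd h (by norm_num), fun h => absurd h hlt⟩⟩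
    obtain ⟨e, hP1, hl1, hg1⟩ := hstep1
    have hrec := ih (y₁ + e) y₂ hl1 hP1 hy₂
    calc |g y₂ - g y₁| = |(g y₂ - g (y₁ + e)) + (g (y₁ + e) - g y₁)| := by ring_nf
      _ ≤ |g y₂ - g (y₁ + e)| + |g (y₁ + e) - g y₁| := abs_add_le _ _
      _ ≤ B * n + B := add_le_add hrec hg1
      _ = B * ((n + 1 : ℕ) : ℝ) := by push_cast; ring

/-- kernel: the path lemma in the sup norm: `|g(y₂) − g(y₁)| ≤ B(d+1)|y₂ − y₁|_∞`. [folklore] -/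
private theorem abs_sub_le_supNorm {P : (Fin (d + 1) → ℤ) → Prop} (hP : BoxConvex P) (g : (Fin (d + 1) → ℤ) → ℝ)
    {B : ℝ} (hB : 0 ≤ B) (hstep : ∀ (y : Fin (d + 1) → ℤ) (i : Fin (d + 1)), P y → P (y + Pi.single i 1) →
      |g (y + Pi.single i 1) - g y| ≤ B) {y₁ y₂ : Fin (d + 1) → ℤ} (hy₁ : P y₁) (hy₂ : P y₂) :
    |g y₂ - g y₁| ≤ B * (((d : ℝ) + 1) * supNorm (y₂ - y₁)) := by
  have h := abs_sub_le_l1 hP g hstep (l1 (y₂ - y₁)) y₁ y₂ rfl hy₁ hy₂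
  exact h.trans (mul_le_mul_of_nonneg_left (l1_le_supNorm _) hB)

/-- The fine sites of a cube `□(v)` inside the box `□ = Π_i[0,N_i)` form a box-convex set. [folklore] -/
private theorem boxConvex_cube {b : ℕ} (hb : 1 ≤ b) (N : Fin (d + 1) → ℕ) (v : Fin (d + 1) → ℤ) :
    BoxConvex (fun y : Fin (d + 1) → ℤ => y ∈ boxDom N ∧ blk b y = v) := by
  intro y₁ y₂ h1 h2 y hy
  have hb0 : (0 : ℤ) < b := by exact_mod_cast hb
  rw [mem_boxDom] at h1 h2 ⊢
  refine ⟨fun i => ?_, funext fun i => ?_⟩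
  · obtain ⟨lo, hi⟩ := hy i
    constructor
    · exact le_trans (le_min (h1.1 i).1 (h2.1 i).1) lo
    · exact lt_of_le_of_lt hi (max_lt (h1.1 i).2 (h2.1 i).2)
  · obtain ⟨lo, hi⟩ := hy i
    have e1 : y₁ i / (b : ℤ) = v i := congr_fun h1.2 i
    have e2 : y₂ i / (b : ℤ) = v i := congr_fun h2.2 i
    show y i / (b : ℤ) = v i
    have hlo : min (y₁ i) (y₂ i) / (b : ℤ) = v i := by
      rcases min_choice (y₁ i) (y₂ i) with h | h <;> rw [h] <;> assumption
    have hhi : max (y₁ i) (y₂ i) / (b : ℤ) = v i := by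
      rcases max_choice (y₁ i) (y₂ i) with h | h <;> rw [h] <;> assumption
    have a1 := Int.ediv_le_ediv hb0 lo
    have a2 := Int.ediv_le_ediv hb0 hi
    rw [hlo] at a1
    rw [hhi] at a2
    exact le_antisymm a2 a1

/-! ## §2 Unit cubes of `□` at depth `r` (label distance `≥ r + 1` from `ηℤ^{d+1}∖□`) -/

section Cubes

variable {M : Fin (d + 1) → ℕ}

/-- **THE CUBE DEPTH**: the unit cube `□(v)` of the box `□ = Π[0,M)` keeps label sup-distance `≥ r + 1` from every unit cube of the
complement `ηℤ^{d+1}∖□`, i.e. `r ≤ v_i ≤ M_i − 1 − r` for all `i` (`dist(□(v), ηℤ^{d+1}∖□) ≥ r` for closed unit cubes in the sup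
norm) — the instance's reading of the distance in the first factor of (2.5) (print: `dist(Ω₂,∂Ω)`; [B4] (1.12): distance of the
localization to the region where the operators differ; p. 433: `dist(□₁,∂□) = r(L^kε)`). [cite: Balaban1983Higgs3, (2.5) p.424] -/
def CubeDepth (M : Fin (d + 1) → ℕ) (r : ℕ) (v : Fin (d + 1) → ℤ) : Prop :=
  ∀ i, (r : ℤ) ≤ v i ∧ v i + r + 1 ≤ M i

/-- a larger cube depth implies a smaller one. [cite: Balaban1983Higgs3, (2.5) p.424] -/
theorem CubeDepth.mono {r r' : ℕ} (h : r' ≤ r) {v : Fin (d + 1) → ℤ} (hv : CubeDepth M r v) : CubeDepth M r' v := fun i => by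
  have := hv i
  have h' : (r' : ℤ) ≤ r := by exact_mod_cast h
  exact ⟨by linarith, by linarith⟩

/-- **every fine point of a cube of cube depth `r` has depth `r`** (`B3DeltaGkZeroLattice.Depth`), at any number `n` of fine points per
unit length. [cite: Balaban1983Higgs3, (2.5) p.424] -/
theorem depth_of_cubeDepth {n : ℕ} {r : ℕ} {v : Fin (d + 1) → ℤ} (hv : CubeDepth M r v) {x : Fin (d + 1) → ℤ}
    (hx : blk n x = v) : Depth n M r x := fun i => by
  rw [hx]; exact hv i

end Cubes

/-! ## §3 The two-variable field `(x,x′) ↦ η^{−(d+1)}δG_k(□,ηℤ^{d+1},0;x,x′)` on `□(v) × □(v′)`, its lattice derivatives in the `2(d+1)`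
directions of the product lattice, and its norm (1.32) -/

section Field

variable (ℓ k : ℕ) (M : Fin (d + 1) → ℕ) (a m2 : ℝ)

/-- The two-variable field of (2.5) for the instance: `F(x,x′) = η^{−(d+1)}δG_k(□,ηℤ^{d+1},0;x,x′)` (`η^{−1} = L^k`; `δG_k(□,ηℤ^{d+1},0) =
B3DeltaGkZeroLattice.dGkLat`, matrix units, so `F` is the kernel in the print's `η^{d+1}`-normalisation `(Gf)(x) = Σ_{x′}η^{d+1}G(x,x′)f(x′)`),
as a function on the PRODUCT lattice `□ × □` of fine sites of `□`; the localization `h ⊗ h′ = 1_{□(v)} ⊗ 1_{□(v′)}` enters through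
the domain `B3Ineq31ZeroBox.sites v v′`. [cite: Balaban1983Higgs3, (2.5) p.424] -/
def kerD (z : ↥(boxDom (Nf ℓ k M)) × ↥(boxDom (Nf ℓ k M))) : ℝ :=
  ((((ℓ + 1) ^ k : ℕ)) : ℝ) ^ (d + 1) * dGkLat ℓ k M a m2 z.1 z.2

/-- The lattice derivatives `∂^ηF` of the two-variable field along the product-lattice bonds (`B3Ineq31ZeroBox.bonds`): `η^{−1}(F(x+e_μ,x′)
− F(x,x′))` on a row bond, `η^{−1}(F(x,x′+e_ν) − F(x,x′))` on a column bond (`U ≡ 1` at `B̃ = 0`). [cite: Balaban1983Higgs3, (1.32) p.420] -/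
def derivD : ((Fin (d + 1) × ((↥(boxDom (Nf ℓ k M)) × ↥(boxDom (Nf ℓ k M))) × ↥(boxDom (Nf ℓ k M)))) ⊕
      (Fin (d + 1) × ((↥(boxDom (Nf ℓ k M)) × ↥(boxDom (Nf ℓ k M))) × ↥(boxDom (Nf ℓ k M))))) → ℝ :=
  Sum.elim (fun b => (((ℓ + 1) ^ k : ℕ) : ℝ) * (kerD ℓ k M a m2 (b.2.2, b.2.1.2) - kerD ℓ k M a m2 b.2.1))
    (fun b => (((ℓ + 1) ^ k : ℕ) : ℝ) * (kerD ℓ k M a m2 (b.2.1.1, b.2.2) - kerD ℓ k M a m2 b.2.1))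

/-- **‖hδG_k(□,ηℤ^{d+1},0)h′‖_{1,α} for the instance**: the printed (1.32) SUM form `B3Sect1Statements.norm132` — `sup|F| + sup|∂F| +
sup|∂F(b′) − ∂F(b)|/|z(b) − z(b′)|^α` over same-direction bond pairs — of `F = η^{−(d+1)}δG_k(□,ηℤ^{d+1},0;·,·)` on the localization domain
`□(v) × □(v′)`, derivatives in all `2(d+1)` directions, transport `U(B̃(Γ)) = id` (`B̃ = 0`); the index sets, directions, base points
and the product sup-distance `pdist` are those of `B3Ineq31ZeroBox` (row B3.Eq3.1, same reading of «extends in a natural way to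
functions of many variables», p. 420). [cite: Balaban1983Higgs3, (2.5) p.424] -/
def normHGH (α : ℝ) (v v' : Fin (d + 1) → ℤ) : ℝ :=
  norm132 α (fun c c' => dirOf ℓ k M c = dirOf ℓ k M c') (fun c c' => pdist ℓ k M (baseOf ℓ k M c) (baseOf ℓ k M c'))
    (fun _ _ => id) (sites ℓ k M v v') (bonds ℓ k M v v') (kerD ℓ k M a m2) (derivD ℓ k M a m2)

/-- `‖hδG_kh′‖_{1,α} ≥ 0`. [cite: Balaban1983Higgs3, (2.5) p.424] -/
theorem normHGH_nonneg (α : ℝ) (v v' : Fin (d + 1) → ℤ) : 0 ≤ normHGH ℓ k M a m2 α v v' := norm132_nonneg _ _ _ _ _ _ _ _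

end Field

/-! ## §4 The concrete carrier of B3 §2 for the `(□, ηℤ^{d+1})` instance and the unfolding of (2.5) -/

section Carrier

/-- **The concrete carrier of (2.5), (2.10)–(2.12) for the MODEL INSTANCE `A = B̃ = 0`, the pair `(□ = Π[0,M), ηℤ^{d+1})`**
(`□ = Π[0,M)` a box of unit blocks in `ηℤ^{d+1}`) at scale `k` (`η = L^{−k}`, `L = ℓ + 1`, window point `(a, m²)`), with the
admitted localizations at cube depth `r₀`: it EXTENDS `B3Ineq210ZeroBox.zeroBoxKernels ℓ k hℓ M a m2` of the box (`Site` = fine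
points of `□`, `dist = η|x − x′|_∞`, `L`, `η`, `d ↦ d+1`, the (2.10) kernels `absG`, `absDG` of `G_k(□,0)` — copied verbatim, so (2.10)
for this carrier is `ineq210_zeroBox`, cf. `ineq210_iff_zeroBox`) by the (2.5) data: `LocFn` = the unit cubes `□(v)` (labels
`v ∈ ℤ^{d+1}`) of CUBE DEPTH `r₀` (`CubeDepth`), `distSupp h h′ = dist(□(v),□(v′))`
(`B3Ineq31ZeroBox.cubeDist`), `distΩ₂ := r₀` (declared reading (i) of the module docstring), `normDeltaG α h h′ = ‖hδG_k(□,ηℤ^{d+1},0)h′‖_{1,α}`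
(`normHGH`).  NOT MODELLED (F7, (ii)): `Bond := Unit`, `dist2 := distBlock := 0`, `eRun := pRun := 0`, `holderDiff := absGavg := 0`,
`norm116 := 0` — nothing is claimed about (2.11), (2.12) or the (1.16) alternative of (2.5) for this carrier.
[cite: Balaban1983Higgs3, (2.5) p.424] -/
def sect2DeltaZeroLattice (ℓ k : ℕ) (hℓ : 1 ≤ ℓ) (M : Fin (d + 1) → ℕ) (a m2 : ℝ) (r₀ : ℕ) : ScaledKernels where
  Site := ↥(boxDom (Nf ℓ k M))
  Bond := Unit
  Dir := Fin (d + 1)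
  LocFn := {v : Fin (d + 1) → ℤ // CubeDepth M r₀ v}
  dist x x' := supNorm (x.1 - x'.1) / (((ℓ + 1) ^ k : ℕ) : ℝ)
  dist2 _ _ _ := 0
  distBlock _ _ _ := 0
  distSupp h h' := cubeDist h.1 h'.1
  distΩ₂ := r₀
  L := (ℓ : ℝ) + 1
  η := ((((ℓ + 1) ^ k : ℕ) : ℝ))⁻¹
  d := d + 1
  eRun := 0
  pRun := 0
  one_lt_L := one_lt_L_real hℓ
  η_pos := inv_pos.2 (by positivity)
  absG j x x' := ((((ℓ + 1) ^ k : ℕ) : ℝ)) ^ (d + 1) * |piece ℓ k M j a m2 x x'|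
  absDG j μ x x' :=
    if h : x.1 + Pi.single μ 1 ∈ boxDom (Nf ℓ k M) then
      ((((ℓ + 1) ^ k : ℕ) : ℝ)) ^ (d + 1)
        * (((((ℓ + 1) ^ k : ℕ) : ℝ)) * |piece ℓ k M j a m2 ⟨x.1 + Pi.single μ 1, h⟩ x' - piece ℓ k M j a m2 x x'|)
    else 0
  holderDiff _ _ _ _ _ := 0
  absGavg _ _ _ := 0
  normDeltaG α h h' := normHGH ℓ k M a m2 α h.1 h'.1
  norm116 _ _ _ _ _ := 0

variable {ℓ k : ℕ} {hℓ : 1 ≤ ℓ} {M : Fin (d + 1) → ℕ} {a m2 : ℝ} {r₀ : ℕ}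

/-- `(2.5)` for the carrier unfolds to the bound on `normHGH` over pairs of admitted cubes (first conjunct) and a triviality for the
unmodelled (1.16) alternative (second conjunct). [cite: Balaban1983Higgs3, (2.5) p.424] -/
theorem ineq25_iff (α δ₀ C : ℝ) :
    (sect2DeltaZeroLattice ℓ k hℓ M a m2 r₀).Ineq25 α δ₀ C ↔
      (∀ h h' : {v : Fin (d + 1) → ℤ // CubeDepth M r₀ v},
          normHGH ℓ k M a m2 α h.1 h'.1 ≤ C * Real.exp (-(δ₀ * (r₀ : ℝ))) * Real.exp (-(δ₀ * cubeDist h.1 h'.1))) ∧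
      (∀ (n n' : ℕ) (h h' : {v : Fin (d + 1) → ℤ // CubeDepth M r₀ v}),
          (0 : ℝ) ≤ C * ((0 : ℝ) * 0) ^ (n + n') * Real.exp (-(δ₀ * cubeDist h.1 h'.1))) := Iff.rfl

/-- `(2.10)` for the carrier IS `(2.10)` for `B3Ineq210ZeroBox.zeroBoxKernels` of the box (the (2.10) fields are copied), hence
discharged by `B3Ineq210ZeroBox.ineq210_zeroBox`. [cite: Balaban1983Higgs3, (2.10) p.426] -/
theorem ineq210_iff_zeroBox (δ₁ C : ℝ) :
    (sect2DeltaZeroLattice ℓ k hℓ M a m2 r₀).Ineq210 δ₁ C ↔ (zeroBoxKernels ℓ k hℓ M a m2).Ineq210 δ₁ C := Iff.rfl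

end Carrier

/-! ## §5 The three parts of (1.32) for `F = η^{−(d+1)}δG_k(□,ηℤ^{d+1},0)` on `□(v) × □(v′)` from cube-wise kernel bounds -/

section Parts

variable {ℓ k : ℕ} {M : Fin (d + 1) → ℕ} {a m2 : ℝ}

/-- kernel: unweighting a Hölder-weighted bound: `(L/s)^α·T ≤ K` gives `T ≤ K·(s/L)^α`. [folklore] -/
private theorem le_of_weight_mul_le {L s α T K : ℝ} (hL : 0 < L) (hs : 0 < s) (h : (L / s) ^ α * T ≤ K) :
    T ≤ K * (s / L) ^ α := by
  have hw : 0 < (L / s) ^ α := Real.rpow_pos_of_pos (div_pos hL hs) α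
  have hinv : (s / L) ^ α = ((L / s) ^ α)⁻¹ := by
    rw [← Real.inv_rpow (div_pos hL hs).le, inv_div]
  rw [hinv, ← div_eq_mul_inv, le_div_iff₀ hw, mul_comm]
  exact h

/-- kernel: `t ≤ t^α` for `0 < t ≤ 1`, `α ≤ 1`. [folklore] -/
private theorem le_rpow_of_le_one {t α : ℝ} (ht0 : 0 < t) (ht1 : t ≤ 1) (hα1 : α ≤ 1) : t ≤ t ^ α := by
  calc t = t ^ (1 : ℝ) := (Real.rpow_one t).symm
    _ ≤ t ^ α := Real.rpow_le_rpow_of_exponent_ge ht0 ht1 hα1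

/-- kernel: two fine points of one unit cube are less than `L^k` apart: `|y − y′|_∞/L^k ≤ 1`. [folklore] -/
private theorem div_le_one_of_blk_eq {y y' : Fin (d + 1) → ℤ} (h : blk ((ℓ + 1) ^ k) y = blk ((ℓ + 1) ^ k) y') :
    supNorm (y - y') / ((((ℓ + 1) ^ k : ℕ)) : ℝ) ≤ 1 := by
  have hb : 1 ≤ (ℓ + 1) ^ k := Nat.one_le_pow _ _ (by omega)
  have hL : (0 : ℝ) < ((((ℓ + 1) ^ k : ℕ)) : ℝ) := by positivity
  have h1 := supNorm_sub_le_of_blk_eq hb h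
  rw [div_le_one hL]
  linarith

/-- **Part 1 of (1.32): `sup_{□(v)×□(v′)} |F| ≤ B_V`** from a cube-wise value bound. [cite: Balaban1983Higgs3, (2.5) p.424] -/
theorem supPart_le {BV : ℝ} (hBV : 0 ≤ BV) {v v' : Fin (d + 1) → ℤ}
    (hV : ∀ x x' : ↥(boxDom (Nf ℓ k M)), blk ((ℓ + 1) ^ k) x.1 = v → blk ((ℓ + 1) ^ k) x'.1 = v' →
      ((((ℓ + 1) ^ k : ℕ)) : ℝ) ^ (d + 1) * |dGkLat ℓ k M a m2 x x'| ≤ BV) :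
    LatticeNorms.supNorm (sites ℓ k M v v') (kerD ℓ k M a m2) ≤ BV := by
  refine LatticeNorms.supNorm_le hBV fun z hz => ?_
  obtain ⟨hz1, hz2⟩ := (mem_filter.1 hz).2
  have hL : (0 : ℝ) ≤ ((((ℓ + 1) ^ k : ℕ)) : ℝ) ^ (d + 1) := by positivity
  rw [Real.norm_eq_abs, kerD, abs_mul, abs_of_nonneg hL]
  exact hV z.1 z.2 hz1 hz2

/-- **Part 2 of (1.32): `sup_{bonds} |∂^ηF| ≤ B_D + B_D′`** from the cube-wise row/column derivative bounds.
[cite: Balaban1983Higgs3, (2.5) p.424] -/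
theorem derivPart_le {BD BD' : ℝ} (hBD : 0 ≤ BD) (hBD' : 0 ≤ BD') {v v' : Fin (d + 1) → ℤ}
    (hDf : ∀ (μ : Fin (d + 1)) (x xe : ↥(boxDom (Nf ℓ k M))), xe.1 = x.1 + Pi.single μ 1 →
      ∀ (x' : ↥(boxDom (Nf ℓ k M))), blk ((ℓ + 1) ^ k) x.1 = v → blk ((ℓ + 1) ^ k) x'.1 = v' →
        ((((ℓ + 1) ^ k : ℕ)) : ℝ) ^ (d + 1) *
            (((((ℓ + 1) ^ k : ℕ)) : ℝ) * |dGkLat ℓ k M a m2 xe x' - dGkLat ℓ k M a m2 x x'|) ≤ BD)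
    (hDf' : ∀ (x : ↥(boxDom (Nf ℓ k M))) (ν : Fin (d + 1)) (x' xe' : ↥(boxDom (Nf ℓ k M))),
      xe'.1 = x'.1 + Pi.single ν 1 → blk ((ℓ + 1) ^ k) x.1 = v → blk ((ℓ + 1) ^ k) x'.1 = v' →
        ((((ℓ + 1) ^ k : ℕ)) : ℝ) ^ (d + 1) *
            (((((ℓ + 1) ^ k : ℕ)) : ℝ) * |dGkLat ℓ k M a m2 x xe' - dGkLat ℓ k M a m2 x x'|) ≤ BD') :
    LatticeNorms.supNorm (bonds ℓ k M v v') (derivD ℓ k M a m2) ≤ BD + BD' := by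
  have hL : (0 : ℝ) ≤ ((((ℓ + 1) ^ k : ℕ)) : ℝ) := by positivity
  have hLp : (0 : ℝ) ≤ ((((ℓ + 1) ^ k : ℕ)) : ℝ) ^ (d + 1) := by positivity
  refine LatticeNorms.supNorm_le (by positivity) fun c hc => ?_
  rcases c with b | b
  · -- a row bond `(μ, (x,x′), x+e_μ)`
    obtain ⟨hz, hxe, -⟩ := (mem_filter.1 (Finset.inl_mem_disjSum.1 hc)).2
    obtain ⟨hz1, hz2⟩ := (mem_filter.1 hz).2
    have h := hDf b.1 b.2.1.1 b.2.2 hxe b.2.1.2 hz1 hz2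
    rw [Real.norm_eq_abs, derivD, Sum.elim_inl, kerD, kerD]
    rw [show (((ℓ + 1) ^ k : ℕ) : ℝ) * ((((ℓ + 1) ^ k : ℕ) : ℝ) ^ (d + 1) * dGkLat ℓ k M a m2 b.2.2 b.2.1.2
          - (((ℓ + 1) ^ k : ℕ) : ℝ) ^ (d + 1) * dGkLat ℓ k M a m2 b.2.1.1 b.2.1.2)
        = (((ℓ + 1) ^ k : ℕ) : ℝ) ^ (d + 1) * ((((ℓ + 1) ^ k : ℕ) : ℝ) *
          (dGkLat ℓ k M a m2 b.2.2 b.2.1.2 - dGkLat ℓ k M a m2 b.2.1.1 b.2.1.2)) from by ring,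
      abs_mul, abs_of_nonneg hLp, abs_mul, abs_of_nonneg hL]
    linarith
  · -- a column bond `(ν, (x,x′), x′+e_ν)`
    obtain ⟨hz, hxe, -⟩ := (mem_filter.1 (Finset.inr_mem_disjSum.1 hc)).2
    obtain ⟨hz1, hz2⟩ := (mem_filter.1 hz).2
    have h := hDf' b.2.1.1 b.1 b.2.1.2 b.2.2 hxe hz1 hz2
    rw [Real.norm_eq_abs, derivD, Sum.elim_inr, kerD, kerD]
    rw [show (((ℓ + 1) ^ k : ℕ) : ℝ) * ((((ℓ + 1) ^ k : ℕ) : ℝ) ^ (d + 1) * dGkLat ℓ k M a m2 b.2.1.1 b.2.2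
          - (((ℓ + 1) ^ k : ℕ) : ℝ) ^ (d + 1) * dGkLat ℓ k M a m2 b.2.1.1 b.2.1.2)
        = (((ℓ + 1) ^ k : ℕ) : ℝ) ^ (d + 1) * ((((ℓ + 1) ^ k : ℕ) : ℝ) *
          (dGkLat ℓ k M a m2 b.2.1.1 b.2.2 - dGkLat ℓ k M a m2 b.2.1.1 b.2.1.2)) from by ring,
      abs_mul, abs_of_nonneg hLp, abs_mul, abs_of_nonneg hL]
    linarith

set_option maxHeartbeats 1600000 in
/-- **Part 3 of (1.32): the Hölder quotients of `∂^ηF` over same-direction bond pairs of `□(v) × □(v′)` are `≤ (B_H + (d+1)B_M) +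
(B_H′ + (d+1)B_M)` times `|z − z′|^α`.**  For two ROW bonds `(μ,(x₁,x₁′))`, `(μ,(x₂,x₂′))` the difference `∂_μF(x₂,x₂′) − ∂_μF(x₁,x₁′)` is
split at `(x₁,x₂′)`: the first half is the Hölder quotient of the row derivative in the row variable (cube-wise clause `hH`, weight
`(L^k/|x₂−x₁|)^α` removed), the second half is a variation in the COLUMN variable inside the unit cube `□(v′)` (`η|x₂′ − x₁′| ≤ 1`, so
`t ≤ t^α`), telescoped along a staircase path inside `□(v′)` with steps bounded by the mixed clause `hMx`; column bonds symmetrically.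
[cite: Balaban1983Higgs3, (2.5) p.424] -/
theorem holderPart_le {α BH BH' BM : ℝ} (hα0 : 0 ≤ α) (hα1 : α < 1) (hBH : 0 ≤ BH) (hBH' : 0 ≤ BH') (hBM : 0 ≤ BM)
    {v v' : Fin (d + 1) → ℤ}
    (hH : ∀ (μ : Fin (d + 1)) (x₁ xe₁ x₂ xe₂ : ↥(boxDom (Nf ℓ k M))), xe₁.1 = x₁.1 + Pi.single μ 1 →
      xe₂.1 = x₂.1 + Pi.single μ 1 → x₂.1 ≠ x₁.1 → ∀ (x' : ↥(boxDom (Nf ℓ k M))),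
      blk ((ℓ + 1) ^ k) x₁.1 = v → blk ((ℓ + 1) ^ k) x₂.1 = v → blk ((ℓ + 1) ^ k) x'.1 = v' →
        ((((ℓ + 1) ^ k : ℕ) : ℝ) / supNorm (x₂.1 - x₁.1)) ^ α *
            (((((ℓ + 1) ^ k : ℕ)) : ℝ) ^ (d + 1) *
              ((((ℓ + 1) ^ k : ℕ) : ℝ) * |(dGkLat ℓ k M a m2 xe₂ x' - dGkLat ℓ k M a m2 x₂ x')
                - (dGkLat ℓ k M a m2 xe₁ x' - dGkLat ℓ k M a m2 x₁ x')|)) ≤ BH)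
    (hH' : ∀ (x : ↥(boxDom (Nf ℓ k M))) (ν : Fin (d + 1)) (x₁' xe₁' x₂' xe₂' : ↥(boxDom (Nf ℓ k M))),
      xe₁'.1 = x₁'.1 + Pi.single ν 1 → xe₂'.1 = x₂'.1 + Pi.single ν 1 → x₂'.1 ≠ x₁'.1 →
      blk ((ℓ + 1) ^ k) x.1 = v → blk ((ℓ + 1) ^ k) x₁'.1 = v' → blk ((ℓ + 1) ^ k) x₂'.1 = v' →
        ((((ℓ + 1) ^ k : ℕ) : ℝ) / supNorm (x₂'.1 - x₁'.1)) ^ α *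
            (((((ℓ + 1) ^ k : ℕ)) : ℝ) ^ (d + 1) *
              ((((ℓ + 1) ^ k : ℕ) : ℝ) * |(dGkLat ℓ k M a m2 x xe₂' - dGkLat ℓ k M a m2 x x₂')
                - (dGkLat ℓ k M a m2 x xe₁' - dGkLat ℓ k M a m2 x x₁')|)) ≤ BH')
    (hMx : ∀ (μ ν : Fin (d + 1)) (x xe : ↥(boxDom (Nf ℓ k M))), xe.1 = x.1 + Pi.single μ 1 →
      ∀ (x' xe' : ↥(boxDom (Nf ℓ k M))), xe'.1 = x'.1 + Pi.single ν 1 →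
      blk ((ℓ + 1) ^ k) x.1 = v → blk ((ℓ + 1) ^ k) x'.1 = v' →
        ((((ℓ + 1) ^ k : ℕ)) : ℝ) ^ (d + 1) *
            (((((ℓ + 1) ^ k : ℕ)) : ℝ) ^ 2 * |(dGkLat ℓ k M a m2 xe xe' - dGkLat ℓ k M a m2 x xe')
              - (dGkLat ℓ k M a m2 xe x' - dGkLat ℓ k M a m2 x x')|) ≤ BM) :
    LatticeNorms.holderSeminorm α (fun c c' => dirOf ℓ k M c = dirOf ℓ k M c')
        (fun c c' => pdist ℓ k M (baseOf ℓ k M c) (baseOf ℓ k M c')) (fun _ _ => id) (bonds ℓ k M v v')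
        (derivD ℓ k M a m2)
      ≤ (BH + ((d : ℝ) + 1) * BM) + (BH' + ((d : ℝ) + 1) * BM) := by
  set L : ℝ := ((((ℓ + 1) ^ k : ℕ)) : ℝ) with hLdef
  have hL : 0 < L := by rw [hLdef]; positivity
  have hLp : 0 < L ^ (d + 1) := pow_pos hL _
  have hb : 1 ≤ (ℓ + 1) ^ k := Nat.one_le_pow _ _ (by omega)
  have hd1 : (0 : ℝ) ≤ (d : ℝ) + 1 := by positivity
  have hK1 : 0 ≤ BH + ((d : ℝ) + 1) * BM := by positivity
  have hK2 : 0 ≤ BH' + ((d : ℝ) + 1) * BM := by positivity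
  -- the factorised form of a derivative value
  have hfac : ∀ (p q r s : ↥(boxDom (Nf ℓ k M))),
      L * (L ^ (d + 1) * dGkLat ℓ k M a m2 p q - L ^ (d + 1) * dGkLat ℓ k M a m2 r s)
        = L ^ (d + 1) * (L * (dGkLat ℓ k M a m2 p q - dGkLat ℓ k M a m2 r s)) := by
    intro p q r s; ring
  refine LatticeNorms.holderSeminorm_le (by positivity) fun c hc c' hc' hdir hpos => ?_
  rw [Real.norm_eq_abs]
  change |derivD ℓ k M a m2 c' - derivD ℓ k M a m2 c|
    ≤ ((BH + ((d : ℝ) + 1) * BM) + (BH' + ((d : ℝ) + 1) * BM))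
      * (pdist ℓ k M (baseOf ℓ k M c) (baseOf ℓ k M c')) ^ α
  rcases c with b₁ | b₁ <;> rcases c' with b₂ | b₂
  · ----------------------------------------------------------------- two ROW bonds
    simp only [dirOf, Sum.elim_inl, Sum.inl.injEq] at hdir
    obtain ⟨hz₁, hxe₁, hbe₁⟩ := (mem_filter.1 (Finset.inl_mem_disjSum.1 hc)).2
    obtain ⟨hz₂, hxe₂, hbe₂⟩ := (mem_filter.1 (Finset.inl_mem_disjSum.1 hc')).2
    obtain ⟨hx₁, hx₁'⟩ := (mem_filter.1 hz₁).2
    obtain ⟨hx₂, hx₂'⟩ := (mem_filter.1 hz₂).2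
    obtain ⟨μ₁, ⟨x₁, x₁'⟩, xe₁⟩ := b₁
    obtain ⟨μ₂, ⟨x₂, x₂'⟩, xe₂⟩ := b₂
    simp only at hdir hxe₁ hxe₂ hbe₁ hbe₂ hx₁ hx₁' hx₂ hx₂' ⊢
    subst hdir
    simp only [baseOf, Sum.elim_inl, derivD, kerD, pdist]
    rw [hfac, hfac]
    set P : ℝ := max (supNorm (x₁.1 - x₂.1)) (supNorm (x₁'.1 - x₂'.1)) / L with hPdef
    have hP0 : 0 ≤ P := div_nonneg (le_trans (supNorm_nonneg _) (le_max_left _ _)) hL.le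
    -- T1: same column `x₂′`, rows `x₁ → x₂`
    have T1 : |L ^ (d + 1) * (L * (dGkLat ℓ k M a m2 xe₂ x₂' - dGkLat ℓ k M a m2 x₂ x₂'))
          - L ^ (d + 1) * (L * (dGkLat ℓ k M a m2 xe₁ x₂' - dGkLat ℓ k M a m2 x₁ x₂'))|
        ≤ BH * P ^ α := by
      by_cases hx : x₂.1 = x₁.1
      · have hxe : xe₂ = xe₁ := Subtype.ext (by rw [hxe₂, hxe₁, hx])
        have hxx : x₂ = x₁ := Subtype.ext hx
        rw [hxe, hxx, sub_self, abs_zero]; positivity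
      · have hs0 : 0 < supNorm (x₂.1 - x₁.1) :=
          lt_of_lt_of_le one_pos (B4StripSumsHolder.one_le_supNorm (sub_ne_zero.2 hx))
        have h := hH μ₁ x₁ xe₁ x₂ xe₂ hxe₁ hxe₂ hx x₂' hx₁ hx₂ hx₂'
        rw [← mul_sub, ← mul_sub, abs_mul, abs_mul, abs_of_pos hLp, abs_of_pos hL]
        have h3 := le_of_weight_mul_le hL hs0 h
        refine h3.trans (mul_le_mul_of_nonneg_left ?_ hBH)
        refine Real.rpow_le_rpow (div_nonneg hs0.le hL.le) ?_ hα0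
        rw [hPdef]
        refine div_le_div_of_nonneg_right ?_ hL.le
        rw [show supNorm (x₂.1 - x₁.1) = supNorm (x₁.1 - x₂.1) from by rw [← supNorm_neg, neg_sub]]
        exact le_max_left _ _
    -- T2: same row bond `(x₁, xe₁)`, columns `x₁′ → x₂′` inside `□(v′)`
    have T2 : |L ^ (d + 1) * (L * (dGkLat ℓ k M a m2 xe₁ x₂' - dGkLat ℓ k M a m2 x₁ x₂'))
          - L ^ (d + 1) * (L * (dGkLat ℓ k M a m2 xe₁ x₁' - dGkLat ℓ k M a m2 x₁ x₁'))|
        ≤ ((d : ℝ) + 1) * BM * P ^ α := by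
      by_cases hx' : x₂'.1 = x₁'.1
      · have hxx : x₂' = x₁' := Subtype.ext hx'
        rw [hxx, sub_self, abs_zero]; positivity
      · have hs1 : 1 ≤ supNorm (x₂'.1 - x₁'.1) := B4StripSumsHolder.one_le_supNorm (sub_ne_zero.2 hx')
        set t : ℝ := supNorm (x₂'.1 - x₁'.1) / L with htdef
        have ht0 : 0 < t := div_pos (lt_of_lt_of_le one_pos hs1) hL
        have ht1 : t ≤ 1 := div_le_one_of_blk_eq (ℓ := ℓ) (k := k) (hx₂'.trans hx₁'.symm)
        have htP : t ≤ P := by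
          rw [htdef, hPdef]
          refine div_le_div_of_nonneg_right ?_ hL.le
          rw [show supNorm (x₂'.1 - x₁'.1) = supNorm (x₁'.1 - x₂'.1) from by rw [← supNorm_neg, neg_sub]]
          exact le_max_right _ _
        have htPα : t ^ α ≤ P ^ α := Real.rpow_le_rpow ht0.le htP hα0
        -- telescoping in the column variable inside `□(v′)`
        set g : (Fin (d + 1) → ℤ) → ℝ := fun y =>
          if h : y ∈ boxDom (Nf ℓ k M) then
            L ^ (d + 1) * (L * (dGkLat ℓ k M a m2 xe₁ ⟨y, h⟩ - dGkLat ℓ k M a m2 x₁ ⟨y, h⟩)) else 0 with hgdef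
        have hgy : ∀ (y : Fin (d + 1) → ℤ) (hy : y ∈ boxDom (Nf ℓ k M)),
            g y = L ^ (d + 1) * (L * (dGkLat ℓ k M a m2 xe₁ ⟨y, hy⟩ - dGkLat ℓ k M a m2 x₁ ⟨y, hy⟩)) := by
          intro y hy; simp only [hgdef, dif_pos hy]
        have hstep : ∀ (y : Fin (d + 1) → ℤ) (i : Fin (d + 1)),
            (y ∈ boxDom (Nf ℓ k M) ∧ blk ((ℓ + 1) ^ k) y = v') →
            ((y + Pi.single i 1) ∈ boxDom (Nf ℓ k M) ∧ blk ((ℓ + 1) ^ k) (y + Pi.single i 1) = v') →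
            |g (y + Pi.single i 1) - g y| ≤ BM / L := by
          intro y i hy hye
          rw [hgy y hy.1, hgy _ hye.1]
          have hm := hMx μ₁ i x₁ xe₁ hxe₁ ⟨y, hy.1⟩ ⟨y + Pi.single i 1, hye.1⟩ rfl hx₁ hy.2
          rw [le_div_iff₀ hL]
          calc |L ^ (d + 1) * (L * (dGkLat ℓ k M a m2 xe₁ ⟨y + Pi.single i 1, hye.1⟩
                  - dGkLat ℓ k M a m2 x₁ ⟨y + Pi.single i 1, hye.1⟩))
                - L ^ (d + 1) * (L * (dGkLat ℓ k M a m2 xe₁ ⟨y, hy.1⟩ - dGkLat ℓ k M a m2 x₁ ⟨y, hy.1⟩))| * L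
              = L ^ (d + 1) * (L ^ 2 * |(dGkLat ℓ k M a m2 xe₁ ⟨y + Pi.single i 1, hye.1⟩
                  - dGkLat ℓ k M a m2 x₁ ⟨y + Pi.single i 1, hye.1⟩)
                  - (dGkLat ℓ k M a m2 xe₁ ⟨y, hy.1⟩ - dGkLat ℓ k M a m2 x₁ ⟨y, hy.1⟩)|) := by
                rw [← mul_sub, ← mul_sub, abs_mul, abs_mul, abs_of_pos hLp, abs_of_pos hL]; ring
            _ ≤ BM := hm
        have hpath := abs_sub_le_supNorm (boxConvex_cube hb (Nf ℓ k M) v') g (by positivity) hstep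
          ⟨x₁'.2, hx₁'⟩ ⟨x₂'.2, hx₂'⟩
        rw [hgy _ x₁'.2, hgy _ x₂'.2] at hpath
        calc _ ≤ BM / L * (((d : ℝ) + 1) * supNorm (x₂'.1 - x₁'.1)) := hpath
          _ = ((d : ℝ) + 1) * BM * t := by rw [htdef]; field_simp
          _ ≤ ((d : ℝ) + 1) * BM * t ^ α :=
              mul_le_mul_of_nonneg_left (le_rpow_of_le_one ht0 ht1 hα1.le) (by positivity)
          _ ≤ ((d : ℝ) + 1) * BM * P ^ α := mul_le_mul_of_nonneg_left htPα (by positivity)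
    calc |L ^ (d + 1) * (L * (dGkLat ℓ k M a m2 xe₂ x₂' - dGkLat ℓ k M a m2 x₂ x₂'))
          - L ^ (d + 1) * (L * (dGkLat ℓ k M a m2 xe₁ x₁' - dGkLat ℓ k M a m2 x₁ x₁'))|
        ≤ |L ^ (d + 1) * (L * (dGkLat ℓ k M a m2 xe₂ x₂' - dGkLat ℓ k M a m2 x₂ x₂'))
            - L ^ (d + 1) * (L * (dGkLat ℓ k M a m2 xe₁ x₂' - dGkLat ℓ k M a m2 x₁ x₂'))|
          + |L ^ (d + 1) * (L * (dGkLat ℓ k M a m2 xe₁ x₂' - dGkLat ℓ k M a m2 x₁ x₂'))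
            - L ^ (d + 1) * (L * (dGkLat ℓ k M a m2 xe₁ x₁' - dGkLat ℓ k M a m2 x₁ x₁'))| := abs_sub_le _ _ _
      _ ≤ BH * P ^ α + ((d : ℝ) + 1) * BM * P ^ α := add_le_add T1 T2
      _ = (BH + ((d : ℝ) + 1) * BM) * P ^ α := by ring
      _ ≤ _ := by
          have : 0 ≤ P ^ α := by positivity
          nlinarith
  · -- a row bond and a column bond never have the same direction
    simp [dirOf] at hdir
  · simp [dirOf] at hdir
  · ----------------------------------------------------------------- two COLUMN bonds
    simp only [dirOf, Sum.elim_inr, Sum.inr.injEq] at hdir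
    obtain ⟨hz₁, hxe₁, hbe₁⟩ := (mem_filter.1 (Finset.inr_mem_disjSum.1 hc)).2
    obtain ⟨hz₂, hxe₂, hbe₂⟩ := (mem_filter.1 (Finset.inr_mem_disjSum.1 hc')).2
    obtain ⟨hx₁, hx₁'⟩ := (mem_filter.1 hz₁).2
    obtain ⟨hx₂, hx₂'⟩ := (mem_filter.1 hz₂).2
    obtain ⟨ν₁, ⟨x₁, x₁'⟩, xe₁'⟩ := b₁
    obtain ⟨ν₂, ⟨x₂, x₂'⟩, xe₂'⟩ := b₂
    simp only at hdir hxe₁ hxe₂ hbe₁ hbe₂ hx₁ hx₁' hx₂ hx₂' ⊢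
    subst hdir
    simp only [baseOf, Sum.elim_inr, derivD, kerD, pdist]
    rw [hfac, hfac]
    set P : ℝ := max (supNorm (x₁.1 - x₂.1)) (supNorm (x₁'.1 - x₂'.1)) / L with hPdef
    have hP0 : 0 ≤ P := div_nonneg (le_trans (supNorm_nonneg _) (le_max_left _ _)) hL.le
    -- T1′: same row `x₂`, column bonds `x₁′ → x₂′`
    have T1 : |L ^ (d + 1) * (L * (dGkLat ℓ k M a m2 x₂ xe₂' - dGkLat ℓ k M a m2 x₂ x₂'))
          - L ^ (d + 1) * (L * (dGkLat ℓ k M a m2 x₂ xe₁' - dGkLat ℓ k M a m2 x₂ x₁'))|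
        ≤ BH' * P ^ α := by
      by_cases hx : x₂'.1 = x₁'.1
      · have hxe : xe₂' = xe₁' := Subtype.ext (by rw [hxe₂, hxe₁, hx])
        have hxx : x₂' = x₁' := Subtype.ext hx
        rw [hxe, hxx, sub_self, abs_zero]; positivity
      · have hs0 : 0 < supNorm (x₂'.1 - x₁'.1) :=
          lt_of_lt_of_le one_pos (B4StripSumsHolder.one_le_supNorm (sub_ne_zero.2 hx))
        have h := hH' x₂ ν₁ x₁' xe₁' x₂' xe₂' hxe₁ hxe₂ hx hx₂ hx₁' hx₂'
        rw [← mul_sub, ← mul_sub, abs_mul, abs_mul, abs_of_pos hLp, abs_of_pos hL]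
        have h3 := le_of_weight_mul_le hL hs0 h
        refine h3.trans (mul_le_mul_of_nonneg_left ?_ hBH')
        refine Real.rpow_le_rpow (div_nonneg hs0.le hL.le) ?_ hα0
        rw [hPdef]
        refine div_le_div_of_nonneg_right ?_ hL.le
        rw [show supNorm (x₂'.1 - x₁'.1) = supNorm (x₁'.1 - x₂'.1) from by rw [← supNorm_neg, neg_sub]]
        exact le_max_right _ _
    -- T2′: same column bond `(x₁′, xe₁′)`, rows `x₁ → x₂` inside `□(v)`
    have T2 : |L ^ (d + 1) * (L * (dGkLat ℓ k M a m2 x₂ xe₁' - dGkLat ℓ k M a m2 x₂ x₁'))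
          - L ^ (d + 1) * (L * (dGkLat ℓ k M a m2 x₁ xe₁' - dGkLat ℓ k M a m2 x₁ x₁'))|
        ≤ ((d : ℝ) + 1) * BM * P ^ α := by
      by_cases hx' : x₂.1 = x₁.1
      · have hxx : x₂ = x₁ := Subtype.ext hx'
        rw [hxx, sub_self, abs_zero]; positivity
      · have hs1 : 1 ≤ supNorm (x₂.1 - x₁.1) := B4StripSumsHolder.one_le_supNorm (sub_ne_zero.2 hx')
        set t : ℝ := supNorm (x₂.1 - x₁.1) / L with htdef
        have ht0 : 0 < t := div_pos (lt_of_lt_of_le one_pos hs1) hL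
        have ht1 : t ≤ 1 := div_le_one_of_blk_eq (ℓ := ℓ) (k := k) (hx₂.trans hx₁.symm)
        have htP : t ≤ P := by
          rw [htdef, hPdef]
          refine div_le_div_of_nonneg_right ?_ hL.le
          rw [show supNorm (x₂.1 - x₁.1) = supNorm (x₁.1 - x₂.1) from by rw [← supNorm_neg, neg_sub]]
          exact le_max_left _ _
        have htPα : t ^ α ≤ P ^ α := Real.rpow_le_rpow ht0.le htP hα0
        -- telescoping in the row variable inside `□(v)`
        set g : (Fin (d + 1) → ℤ) → ℝ := fun y =>
          if h : y ∈ boxDom (Nf ℓ k M) then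
            L ^ (d + 1) * (L * (dGkLat ℓ k M a m2 ⟨y, h⟩ xe₁' - dGkLat ℓ k M a m2 ⟨y, h⟩ x₁')) else 0 with hgdef
        have hgy : ∀ (y : Fin (d + 1) → ℤ) (hy : y ∈ boxDom (Nf ℓ k M)),
            g y = L ^ (d + 1) * (L * (dGkLat ℓ k M a m2 ⟨y, hy⟩ xe₁' - dGkLat ℓ k M a m2 ⟨y, hy⟩ x₁')) := by
          intro y hy; simp only [hgdef, dif_pos hy]
        have hstep : ∀ (y : Fin (d + 1) → ℤ) (i : Fin (d + 1)),
            (y ∈ boxDom (Nf ℓ k M) ∧ blk ((ℓ + 1) ^ k) y = v) →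
            ((y + Pi.single i 1) ∈ boxDom (Nf ℓ k M) ∧ blk ((ℓ + 1) ^ k) (y + Pi.single i 1) = v) →
            |g (y + Pi.single i 1) - g y| ≤ BM / L := by
          intro y i hy hye
          rw [hgy y hy.1, hgy _ hye.1]
          have hm := hMx i ν₁ ⟨y, hy.1⟩ ⟨y + Pi.single i 1, hye.1⟩ rfl x₁' xe₁' hxe₁ hy.2 hx₁'
          rw [le_div_iff₀ hL]
          calc |L ^ (d + 1) * (L * (dGkLat ℓ k M a m2 ⟨y + Pi.single i 1, hye.1⟩ xe₁'
                  - dGkLat ℓ k M a m2 ⟨y + Pi.single i 1, hye.1⟩ x₁'))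
                - L ^ (d + 1) * (L * (dGkLat ℓ k M a m2 ⟨y, hy.1⟩ xe₁' - dGkLat ℓ k M a m2 ⟨y, hy.1⟩ x₁'))| * L
              = L ^ (d + 1) * (L ^ 2 * |(dGkLat ℓ k M a m2 ⟨y + Pi.single i 1, hye.1⟩ xe₁'
                  - dGkLat ℓ k M a m2 ⟨y, hy.1⟩ xe₁')
                  - (dGkLat ℓ k M a m2 ⟨y + Pi.single i 1, hye.1⟩ x₁' - dGkLat ℓ k M a m2 ⟨y, hy.1⟩ x₁')|) := by
                rw [← mul_sub, ← mul_sub, abs_mul, abs_mul, abs_of_pos hLp, abs_of_pos hL,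
                  show ∀ p q r s : ℝ, (p - q) - (r - s) = (p - r) - (q - s) from fun p q r s => by ring]
                ring
            _ ≤ BM := hm
        have hpath := abs_sub_le_supNorm (boxConvex_cube hb (Nf ℓ k M) v) g (by positivity) hstep
          ⟨x₁.2, hx₁⟩ ⟨x₂.2, hx₂⟩
        rw [hgy _ x₁.2, hgy _ x₂.2] at hpath
        calc _ ≤ BM / L * (((d : ℝ) + 1) * supNorm (x₂.1 - x₁.1)) := hpath
          _ = ((d : ℝ) + 1) * BM * t := by rw [htdef]; field_simp
          _ ≤ ((d : ℝ) + 1) * BM * t ^ α :=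
              mul_le_mul_of_nonneg_left (le_rpow_of_le_one ht0 ht1 hα1.le) (by positivity)
          _ ≤ ((d : ℝ) + 1) * BM * P ^ α := mul_le_mul_of_nonneg_left htPα (by positivity)
    calc |L ^ (d + 1) * (L * (dGkLat ℓ k M a m2 x₂ xe₂' - dGkLat ℓ k M a m2 x₂ x₂'))
          - L ^ (d + 1) * (L * (dGkLat ℓ k M a m2 x₁ xe₁' - dGkLat ℓ k M a m2 x₁ x₁'))|
        ≤ |L ^ (d + 1) * (L * (dGkLat ℓ k M a m2 x₂ xe₂' - dGkLat ℓ k M a m2 x₂ x₂'))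
            - L ^ (d + 1) * (L * (dGkLat ℓ k M a m2 x₂ xe₁' - dGkLat ℓ k M a m2 x₂ x₁'))|
          + |L ^ (d + 1) * (L * (dGkLat ℓ k M a m2 x₂ xe₁' - dGkLat ℓ k M a m2 x₂ x₁'))
            - L ^ (d + 1) * (L * (dGkLat ℓ k M a m2 x₁ xe₁' - dGkLat ℓ k M a m2 x₁ x₁'))| := abs_sub_le _ _ _
      _ ≤ BH' * P ^ α + ((d : ℝ) + 1) * BM * P ^ α := add_le_add T1 T2
      _ = (BH' + ((d : ℝ) + 1) * BM) * P ^ α := by ring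
      _ ≤ _ := by
          have : 0 ≤ P ^ α := by positivity
          nlinarith

/-- **The norm (1.32) of `hδG_k(□,ηℤ^{d+1},0)h′` from cube-wise kernel bounds**: `‖hδG_kh′‖_{1,α} ≤ B_V + (B_D + B_D′) + ((B_H + (d+1)B_M) +
(B_H′ + (d+1)B_M))`. [cite: Balaban1983Higgs3, (2.5) p.424] -/
theorem normHGH_le {α BV BD BD' BH BH' BM : ℝ} (hα0 : 0 ≤ α) (hα1 : α < 1) (hBV : 0 ≤ BV) (hBD : 0 ≤ BD)
    (hBD' : 0 ≤ BD') (hBH : 0 ≤ BH) (hBH' : 0 ≤ BH') (hBM : 0 ≤ BM) {v v' : Fin (d + 1) → ℤ}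
    (hV : ∀ x x' : ↥(boxDom (Nf ℓ k M)), blk ((ℓ + 1) ^ k) x.1 = v → blk ((ℓ + 1) ^ k) x'.1 = v' →
      ((((ℓ + 1) ^ k : ℕ)) : ℝ) ^ (d + 1) * |dGkLat ℓ k M a m2 x x'| ≤ BV)
    (hDf : ∀ (μ : Fin (d + 1)) (x xe : ↥(boxDom (Nf ℓ k M))), xe.1 = x.1 + Pi.single μ 1 →
      ∀ (x' : ↥(boxDom (Nf ℓ k M))), blk ((ℓ + 1) ^ k) x.1 = v → blk ((ℓ + 1) ^ k) x'.1 = v' →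
        ((((ℓ + 1) ^ k : ℕ)) : ℝ) ^ (d + 1) *
            (((((ℓ + 1) ^ k : ℕ)) : ℝ) * |dGkLat ℓ k M a m2 xe x' - dGkLat ℓ k M a m2 x x'|) ≤ BD)
    (hDf' : ∀ (x : ↥(boxDom (Nf ℓ k M))) (ν : Fin (d + 1)) (x' xe' : ↥(boxDom (Nf ℓ k M))),
      xe'.1 = x'.1 + Pi.single ν 1 → blk ((ℓ + 1) ^ k) x.1 = v → blk ((ℓ + 1) ^ k) x'.1 = v' →
        ((((ℓ + 1) ^ k : ℕ)) : ℝ) ^ (d + 1) *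
            (((((ℓ + 1) ^ k : ℕ)) : ℝ) * |dGkLat ℓ k M a m2 x xe' - dGkLat ℓ k M a m2 x x'|) ≤ BD')
    (hH : ∀ (μ : Fin (d + 1)) (x₁ xe₁ x₂ xe₂ : ↥(boxDom (Nf ℓ k M))), xe₁.1 = x₁.1 + Pi.single μ 1 →
      xe₂.1 = x₂.1 + Pi.single μ 1 → x₂.1 ≠ x₁.1 → ∀ (x' : ↥(boxDom (Nf ℓ k M))),
      blk ((ℓ + 1) ^ k) x₁.1 = v → blk ((ℓ + 1) ^ k) x₂.1 = v → blk ((ℓ + 1) ^ k) x'.1 = v' →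
        ((((ℓ + 1) ^ k : ℕ) : ℝ) / supNorm (x₂.1 - x₁.1)) ^ α *
            (((((ℓ + 1) ^ k : ℕ)) : ℝ) ^ (d + 1) *
              ((((ℓ + 1) ^ k : ℕ) : ℝ) * |(dGkLat ℓ k M a m2 xe₂ x' - dGkLat ℓ k M a m2 x₂ x')
                - (dGkLat ℓ k M a m2 xe₁ x' - dGkLat ℓ k M a m2 x₁ x')|)) ≤ BH)
    (hH' : ∀ (x : ↥(boxDom (Nf ℓ k M))) (ν : Fin (d + 1)) (x₁' xe₁' x₂' xe₂' : ↥(boxDom (Nf ℓ k M))),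
      xe₁'.1 = x₁'.1 + Pi.single ν 1 → xe₂'.1 = x₂'.1 + Pi.single ν 1 → x₂'.1 ≠ x₁'.1 →
      blk ((ℓ + 1) ^ k) x.1 = v → blk ((ℓ + 1) ^ k) x₁'.1 = v' → blk ((ℓ + 1) ^ k) x₂'.1 = v' →
        ((((ℓ + 1) ^ k : ℕ) : ℝ) / supNorm (x₂'.1 - x₁'.1)) ^ α *
            (((((ℓ + 1) ^ k : ℕ)) : ℝ) ^ (d + 1) *
              ((((ℓ + 1) ^ k : ℕ) : ℝ) * |(dGkLat ℓ k M a m2 x xe₂' - dGkLat ℓ k M a m2 x x₂')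
                - (dGkLat ℓ k M a m2 x xe₁' - dGkLat ℓ k M a m2 x x₁')|)) ≤ BH')
    (hMx : ∀ (μ ν : Fin (d + 1)) (x xe : ↥(boxDom (Nf ℓ k M))), xe.1 = x.1 + Pi.single μ 1 →
      ∀ (x' xe' : ↥(boxDom (Nf ℓ k M))), xe'.1 = x'.1 + Pi.single ν 1 →
      blk ((ℓ + 1) ^ k) x.1 = v → blk ((ℓ + 1) ^ k) x'.1 = v' →
        ((((ℓ + 1) ^ k : ℕ)) : ℝ) ^ (d + 1) *
            (((((ℓ + 1) ^ k : ℕ)) : ℝ) ^ 2 * |(dGkLat ℓ k M a m2 xe xe' - dGkLat ℓ k M a m2 x xe')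
              - (dGkLat ℓ k M a m2 xe x' - dGkLat ℓ k M a m2 x x')|) ≤ BM) :
    normHGH ℓ k M a m2 α v v' ≤ BV + (BD + BD') + ((BH + ((d : ℝ) + 1) * BM) + (BH' + ((d : ℝ) + 1) * BM)) := by
  unfold normHGH norm132
  exact add_le_add (add_le_add (supPart_le hBV hV) (derivPart_le hBD hBD' hDf hDf'))
    (holderPart_le hα0 hα1 hBH hBH' hBM hH hH' hMx)

end Parts

/-! ## §6 (2.5) DISCHARGED for the `(□, ηℤ^{d+1})` instance, for each Hölder exponent `0 ≤ α < 1` -/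

/-- kernel: `dist(□(v),□(v′)) = dist(□(v′),□(v))`. [folklore] -/
private theorem cubeDist_comm (v v' : Fin (d + 1) → ℤ) : cubeDist v v' = cubeDist v' v := by
  unfold B3Ineq31ZeroBox.cubeDist
  rw [supNorm_sub_comm v v']

/-- kernel: the exponential at the actual fine distance of two cube points is at most the exponential at the cube distance, and the
rate may be lowered. [folklore] -/
private theorem exp_pair_le {δ δ₁ : ℝ} (hδ : 0 ≤ δ) (hδ₁ : δ ≤ δ₁) {ℓ k : ℕ} {x x' v v' : Fin (d + 1) → ℤ}
    (hx : blk ((ℓ + 1) ^ k) x = v) (hx' : blk ((ℓ + 1) ^ k) x' = v') :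
    Real.exp (-(δ₁ * (supNorm (x - x') / ((((ℓ + 1) ^ k : ℕ)) : ℝ)))) ≤ Real.exp (-(δ * cubeDist v v')) := by
  have hb : 1 ≤ (ℓ + 1) ^ k := Nat.one_le_pow _ _ (by omega)
  have hL : (0 : ℝ) < ((((ℓ + 1) ^ k : ℕ)) : ℝ) := by positivity
  have h1 := cubeDist_mul_le_supNorm hb hx hx'
  have h2 : cubeDist v v' ≤ supNorm (x - x') / ((((ℓ + 1) ^ k : ℕ)) : ℝ) := by
    rw [le_div_iff₀ hL]; push_cast at h1 ⊢; linarith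
  have h3 := cubeDist_nonneg v v'
  exact Real.exp_le_exp.2 (by nlinarith)

/-- kernel: the same with a minimum of two distances from points of the same cube. [folklore] -/
private theorem exp_pair_min_le {δ δ₁ : ℝ} (hδ : 0 ≤ δ) (hδ₁ : δ ≤ δ₁) {ℓ k : ℕ} {x₁ x₂ x' v v' : Fin (d + 1) → ℤ}
    (hx₁ : blk ((ℓ + 1) ^ k) x₁ = v) (hx₂ : blk ((ℓ + 1) ^ k) x₂ = v) (hx' : blk ((ℓ + 1) ^ k) x' = v') :
    Real.exp (-(δ₁ * (min (supNorm (x₁ - x')) (supNorm (x₂ - x')) / ((((ℓ + 1) ^ k : ℕ)) : ℝ))))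
      ≤ Real.exp (-(δ * cubeDist v v')) := by
  have hb : 1 ≤ (ℓ + 1) ^ k := Nat.one_le_pow _ _ (by omega)
  have hL : (0 : ℝ) < ((((ℓ + 1) ^ k : ℕ)) : ℝ) := by positivity
  have h1 := cubeDist_mul_le_supNorm hb hx₁ hx'
  have h1' := cubeDist_mul_le_supNorm hb hx₂ hx'
  have h2 : cubeDist v v' ≤ min (supNorm (x₁ - x')) (supNorm (x₂ - x')) / ((((ℓ + 1) ^ k : ℕ)) : ℝ) := by
    rw [le_div_iff₀ hL]; push_cast at h1 h1' ⊢
    rcases min_choice (supNorm (x₁ - x')) (supNorm (x₂ - x')) with h | h <;> rw [h] <;> linarith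
  have h3 := cubeDist_nonneg v v'
  exact Real.exp_le_exp.2 (by nlinarith)

/-- kernel: lowering the rate in the margin factor. [folklore] -/
private theorem exp_margin_le {δ δ₁ : ℝ} (hδ₁ : δ ≤ δ₁) (r : ℕ) : Real.exp (-(δ₁ * r)) ≤ Real.exp (-(δ * r)) :=
  Real.exp_le_exp.2 (by nlinarith [Nat.cast_nonneg (α := ℝ) r])

/-- kernel: a clause bound `C₁e^{−δ₁r}E₁ ≤ C₁e^{−δr}E` once `E₁ ≤ E` and the rate is lowered. [folklore] -/
private theorem clause_le {C₁ δ δ₁ E₁ E t : ℝ} (hC : 0 ≤ C₁) (hδ₁ : δ ≤ δ₁) (r : ℕ) (hE : E₁ ≤ E) (hE₁ : 0 ≤ E₁)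
    (ht : t ≤ C₁ * Real.exp (-(δ₁ * r)) * E₁) : t ≤ C₁ * Real.exp (-(δ * r)) * E := by
  have h1 := exp_margin_le hδ₁ r
  have h2 : 0 ≤ Real.exp (-(δ * (r : ℝ))) := (Real.exp_pos _).le
  calc t ≤ C₁ * Real.exp (-(δ₁ * r)) * E₁ := ht
    _ ≤ C₁ * Real.exp (-(δ * r)) * E₁ := mul_le_mul_of_nonneg_right (mul_le_mul_of_nonneg_left h1 hC) hE₁
    _ ≤ C₁ * Real.exp (-(δ * r)) * E := mul_le_mul_of_nonneg_left hE (mul_nonneg hC h2)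

/-- **B3 (2.5) — the `δG_k(Ω,Ω₂,B̃)` alternative — DISCHARGED for the MODEL INSTANCE `A = B̃ = 0`, the pair `(□, ηℤ^{d+1})` of p. 433,
unit-cube localizations at cube depth `r₀ ≥ 3`, for each Hölder exponent `0 ≤ α < 1`.**  There are `δ₀ > 0` and `C > 0` (depending
on `d`, `L = ℓ + 1`, the window and `α` — «c₀ on α also», [B4] Thm 1.2) such that for every scale `k ≥ 1` (`η = L^{−k}`), every window
point `(a, m²)`, every box `□ = Π[0,M)` of unit blocks and every `r₀ ≥ 3`, `(sect2DeltaZeroLattice ℓ k hℓ M a m2 r₀).Ineq25 α δ₀ C` holds,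
i.e. `‖hδG_k(□,ηℤ^{d+1},0)h′‖_{1,α} ≤ C·e^{−δ₀r₀}·e^{−δ₀dist(□(v),□(v′))}` for all admitted cubes `h = □(v)`, `h′ = □(v′)` — INCLUDING
coincident and adjacent cubes (the kernel is regular on the diagonal).  Print (2.5) p. 424: *"‖h(an operator δG_k(Ω,Ω₂,B̃) or
(1.16))h′‖_{1,α} ≤ O(e^{−δ₀dist(Ω₂,∂Ω)} or (e(L^kε)p(L^kε))^{n+n′})e^{−δ₀dist(supp h,supp h′)}"*; p. 433: *"we substitute G_k(□,0) =
G_k(0) + δG_k(□,ηZ^d,0) and we treat δG_k as an external scalar field"*.  Proof: the six kernel clauses of `B3DeltaGkZeroLattice` at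
the common rate, every fine point of an admitted cube having depth `r₀` (`depth_of_cubeDepth`), `e^{−δη|x−x′|} ≤ e^{−δ·dist(□(v),□(v′))}`,
assembled by `normHGH_le`. [cite: Balaban1983Higgs3, (2.5) p.424] -/
theorem ineq25_zeroLattice (d ℓ : ℕ) (hℓ : 1 ≤ ℓ) (amin aplus m2plus : ℝ) (ha : 0 < amin) {α : ℝ} (hα0 : 0 ≤ α)
    (hα1 : α < 1) :
    ∃ δ₀ C : ℝ, 0 < δ₀ ∧ 0 < C ∧ ∀ (k : ℕ), 1 ≤ k → ∀ (a m2 : ℝ), amin ≤ a → a ≤ aplus → 0 ≤ m2 → m2 ≤ m2plus →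
      ∀ (M : Fin (d + 1) → ℕ), (∀ i, 1 ≤ M i) →
      ∀ (r₀ : ℕ), 3 ≤ r₀ → (sect2DeltaZeroLattice ℓ k hℓ M a m2 r₀).Ineq25 α δ₀ C := by
  obtain ⟨δV, CV, hδV, hCV, hV⟩ := abs_dGkLat_le d ℓ hℓ amin aplus m2plus ha
  obtain ⟨δD, CD, hδD, hCD, hD⟩ := abs_dGkLatDiff_le d ℓ hℓ amin aplus m2plus ha
  obtain ⟨δD', CD', hδD', hCD', hD'⟩ := abs_dGkLatDiff'_le d ℓ hℓ amin aplus m2plus ha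
  obtain ⟨δH, CH, hδH, hCH, hH⟩ := abs_dGkLatDD_le d ℓ hℓ amin aplus m2plus ha hα0 hα1
  obtain ⟨δH', CH', hδH', hCH', hH'⟩ := abs_dGkLatDD'_le d ℓ hℓ amin aplus m2plus ha hα0 hα1
  obtain ⟨δM, CM, hδM, hCM, hMx⟩ := abs_dGkLatMixed_le d ℓ hℓ amin aplus m2plus ha
  set δ : ℝ := min (min δV (min δD δD')) (min δH (min δH' δM)) with hδdef
  have hδ : 0 < δ := lt_min (lt_min hδV (lt_min hδD hδD')) (lt_min hδH (lt_min hδH' hδM))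
  have lV : δ ≤ δV := (min_le_left _ _).trans (min_le_left _ _)
  have lD : δ ≤ δD := ((min_le_left _ _).trans (min_le_right _ _)).trans (min_le_left _ _)
  have lD' : δ ≤ δD' := ((min_le_left _ _).trans (min_le_right _ _)).trans (min_le_right _ _)
  have lH : δ ≤ δH := (min_le_right _ _).trans (min_le_left _ _)
  have lH' : δ ≤ δH' := ((min_le_right _ _).trans (min_le_right _ _)).trans (min_le_left _ _)
  have lM : δ ≤ δM := ((min_le_right _ _).trans (min_le_right _ _)).trans (min_le_right _ _)
  set C : ℝ := CV + (CD + CD') + ((CH + ((d : ℝ) + 1) * CM) + (CH' + ((d : ℝ) + 1) * CM)) with hCdef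
  have hd1 : (0 : ℝ) ≤ (d : ℝ) + 1 := by positivity
  have hC : 0 < C := by rw [hCdef]; positivity
  refine ⟨δ, C, hδ, hC, ?_⟩
  intro k hk a m2 h1 h2 h3 h4 M hM r₀ hr₀
  rw [ineq25_iff]
  refine ⟨fun h h' => ?_, fun n n' h h' => by positivity⟩
  obtain ⟨v, hv⟩ := h
  obtain ⟨v', hv'⟩ := h'
  simp only
  set E : ℝ := Real.exp (-(δ * cubeDist v v')) with hEdef
  have hE : 0 < E := Real.exp_pos _
  set R : ℝ := Real.exp (-(δ * (r₀ : ℝ))) with hRdef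
  have hR : 0 < R := Real.exp_pos _
  -- every fine point of the two cubes has depth `r₀`
  have mg : ∀ {x : ↥(boxDom (Nf ℓ k M))}, blk ((ℓ + 1) ^ k) x.1 = v → Depth ((ℓ + 1) ^ k) M r₀ x.1 :=
    fun hx => depth_of_cubeDepth hv hx
  have mg' : ∀ {x : ↥(boxDom (Nf ℓ k M))}, blk ((ℓ + 1) ^ k) x.1 = v' → Depth ((ℓ + 1) ^ k) M r₀ x.1 :=
    fun hx => depth_of_cubeDepth hv' hx
  have key := normHGH_le (M := M) (a := a) (m2 := m2) hα0 hα1 (BV := CV * R * E) (BD := CD * R * E) (BD' := CD' * R * E)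
    (BH := CH * R * E) (BH' := CH' * R * E) (BM := CM * R * E) (by positivity) (by positivity) (by positivity)
    (by positivity) (by positivity) (by positivity) (v := v) (v' := v')
    (fun x x' hx hx' => clause_le hCV.le lV r₀ (exp_pair_le hδ.le lV hx hx') (Real.exp_pos _).le
      (hV k hk a m2 h1 h2 h3 h4 M hM r₀ hr₀ x x' (mg hx) (mg' hx')))
    (fun μ x xe hxe x' hx hx' => clause_le hCD.le lD r₀ (exp_pair_le hδ.le lD hx hx') (Real.exp_pos _).le
      (hD k hk a m2 h1 h2 h3 h4 M hM r₀ hr₀ μ x xe hxe x' (mg hx) (mg' hx')))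
    (fun x ν x' xe' hxe' hx hx' => clause_le hCD'.le lD' r₀ (exp_pair_le hδ.le lD' hx hx') (Real.exp_pos _).le
      (hD' k hk a m2 h1 h2 h3 h4 M hM r₀ hr₀ x ν x' xe' hxe' (mg hx) (mg' hx')))
    (fun μ x₁ xe₁ x₂ xe₂ hxe₁ hxe₂ hne x' hx₁ hx₂ hx' => clause_le hCH.le lH r₀ (exp_pair_min_le hδ.le lH hx₁ hx₂ hx')
      (Real.exp_pos _).le
      (hH k hk a m2 h1 h2 h3 h4 M hM r₀ hr₀ μ x₁ xe₁ x₂ xe₂ hxe₁ hxe₂ hne x' (mg hx₁) (mg hx₂) (mg' hx')))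
    (fun x ν x₁' xe₁' x₂' xe₂' hxe₁ hxe₂ hne hx hx₁' hx₂' => by
      have t := hH' k hk a m2 h1 h2 h3 h4 M hM r₀ hr₀ x ν x₁' xe₁' x₂' xe₂' hxe₁ hxe₂ hne (mg hx) (mg' hx₁') (mg' hx₂')
      refine clause_le hCH'.le lH' r₀ ?_ (Real.exp_pos _).le t
      have e := exp_pair_min_le (δ := δ) hδ.le lH' hx₁' hx₂' hx
      rw [supNorm_sub_comm x.1 x₁'.1, supNorm_sub_comm x.1 x₂'.1, hEdef, cubeDist_comm v v']
      exact e)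
    (fun μ ν x xe hxe x' xe' hxe' hx hx' => clause_le hCM.le lM r₀ (exp_pair_le hδ.le lM hx hx') (Real.exp_pos _).le
      (hMx k hk a m2 h1 h2 h3 h4 M hM r₀ hr₀ μ ν x xe hxe x' xe' hxe' (mg hx) (mg' hx')))
  calc normHGH ℓ k M a m2 α v v'
      ≤ CV * R * E + (CD * R * E + CD' * R * E)
        + ((CH * R * E + ((d : ℝ) + 1) * (CM * R * E)) + (CH' * R * E + ((d : ℝ) + 1) * (CM * R * E))) := key
    _ = C * R * E := by rw [hCdef]; ring

/-! ## §7 Non-vacuity: the binders are inhabited (`d + 1 = 3`, `L = 2`, `k = 1`, window `[1,1] × [0,1]`, `α = 1/2`, `□ = [0,7)³`,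
`r₀ = 3`; the central unit cube `□((3,3,3))` of `□` has cube depth `3`) -/

/-- the central unit cube (label `(3,3,3)`) of `□ = [0,7)³` has cube depth `3`. [folklore] -/
private theorem witness_cubeDepth : CubeDepth (fun _ : Fin 3 => 7) 3 (fun _ : Fin 3 => (3 : ℤ)) := fun _ => by norm_num

/-- The constants of `ineq25_zeroLattice` exist and (2.5) is a genuine inequality at the witness instance: both localizations the
central unit cube of `□` (coincident cubes are allowed), `α = 1/2`. [cite: Balaban1983Higgs3, (2.5) p.424] -/
theorem ineq25_zeroLattice_witness :
    ∃ δ₀ C : ℝ, 0 < δ₀ ∧ 0 < C ∧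
      (sect2DeltaZeroLattice (d := 2) 1 1 le_rfl (fun _ : Fin 3 => 7) (1 : ℝ) (0 : ℝ) 3).Ineq25 (1 / 2) δ₀ C ∧
      normHGH (d := 2) 1 1 (fun _ : Fin 3 => 7) (1 : ℝ) (0 : ℝ) (1 / 2) (fun _ => (3 : ℤ)) (fun _ => (3 : ℤ))
        ≤ C * Real.exp (-(δ₀ * ((3 : ℕ) : ℝ))) * Real.exp (-(δ₀ * cubeDist (fun _ : Fin 3 => (3 : ℤ)) (fun _ => (3 : ℤ)))) := by
  obtain ⟨δ₀, C, hδ₀, hC, h⟩ := ineq25_zeroLattice 2 1 le_rfl 1 1 1 one_pos (α := 1 / 2) (by norm_num) (by norm_num)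
  have h1 := h 1 le_rfl 1 0 le_rfl le_rfl le_rfl zero_le_one (fun _ => 7) (fun _ => by norm_num) 3 le_rfl
  refine ⟨δ₀, C, hδ₀, hC, h1, ?_⟩
  exact ((ineq25_iff _ _ _).1 h1).1 ⟨_, witness_cubeDepth⟩ ⟨_, witness_cubeDepth⟩

end

end Literature.MathematicalPhysics.QuantumFieldTheory.Balaban1983to89.B3Ineq25ZeroLattice
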